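import Summits.HubbardSuperconductivity.HubbardLadder.PsdCert
import HarnessLib

/-!
# PsdCertFactor — the supplied-factor and row-banded forms of the kernel PSD certificate

HONEST FRAMING: ladder R1–R4 with certified numbers; no claim on H/H₀; first certified bounds; not a superconductivity
verdict.  Pure integer linear algebra; cell pub-hubbard, lane r2-eng-1 (g12); companion of the tree's `PsdCertCheck` / `PsdCert`.

WHY: the kernel caches every reduction it performs, so ONE declaration's memory grows with its total work; measured on the farm
(`pub-hubbard-r2-eng-1/psdcert-g12/`), the in-kernel-factoring certificate `psdCert` tops out near block size `m ≈ 95–100`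
(«(kernel) excessive memory consumption» at `m = 105`).  Two remedies, both proved sound here from the SAME verified core
(`ddRows`, `dot3`, `erow`, the Gershgorin and Gram lemmas of `PsdCert`):
* `psdCertWith n s D L B` — the fixed-point factor `(D̂, L̂)` is SUPPLIED as data (any integers; soundness never asks where they
  came from), the kernel only forms the exact residual `E = s²B − L̂D̂L̂ᵀ` and tests `D̂ ≥ 0` + row diagonal dominance (half the work
  of `psdCert`; the shape of lineage B's «limb X»);
* row BANDS: `ddBand … i₀ c` tests rows `i₀ ≤ i < i₀ + c` only, so a large block is certified by several `decide +kernel`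
  declarations (each a fresh kernel check) recombined by `ddRows_drop_of_band` / `form_nonneg_of_shape_dd`.
Main results: `form_nonneg_of_shape_dd`, `form_nonneg_of_psdCertWith`, `posSemidef_of_psdCertWith`, `ddRows_drop_of_band`,
`ddRows_drop_length`.  References: Golub–Van Loan (2013) §4.1; Horn–Johnson (2013) Thm 6.1.10; Rump (2006). All statements [folklore].
-/

namespace Summit.HubbardSuperconductivity.HubbardLadder.PsdCert

open Finset

/-! ## §1 The supplied-factor check and its banded form -/

/-- Shape part of the supplied-factor certificate: `0 < s`, `B` is `n × n` and symmetric, `L̂` has `n` rows, all pivots `D̂ ≥ 0`. [folklore] -/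
def psdShape (n s : ℕ) (D : List ℤ) (Lrows B : List (List ℤ)) : Bool :=
  decide (0 < s) && isSquare n B && isSymm n B && decide (Lrows.length = n) && D.all (fun d => decide (0 ≤ d))

/-- **Supplied-factor certificate**: shape + diagonal dominance of every row of `E = s²B − L̂ D̂ L̂ᵀ`. [folklore] -/
def psdCertWith (n s : ℕ) (D : List ℤ) (Lrows B : List (List ℤ)) : Bool :=
  psdShape n s D Lrows B && ddRows ((s : ℤ) * s) D Lrows 0 B Lrows

/-- **One row band** of the residual test: rows `i₀ ≤ i < i₀ + c` of `E` are diagonally dominant. [folklore] -/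
def ddBand (s : ℕ) (D : List ℤ) (Lrows B : List (List ℤ)) (i0 c : ℕ) : Bool :=
  ddRows ((s : ℤ) * s) D Lrows i0 ((B.drop i0).take c) ((Lrows.drop i0).take c)

/-! ## §2 Combining bands -/

/-- `ddRows` over an appended row list splits into the two parts (equal lengths on the first part). [folklore] -/
theorem ddRows_append (s2 : ℤ) (D : List ℤ) (L : List (List ℤ)) :
    ∀ (X P Y Q : List (List ℤ)) (i0 : ℕ), X.length = P.length →
      ddRows s2 D L i0 (X ++ Y) (P ++ Q) = (ddRows s2 D L i0 X P && ddRows s2 D L (i0 + X.length) Y Q) := by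
  intro X
  induction X with
  | nil =>
    intro P Y Q i0 h
    cases P with
    | nil => simp [ddRows]
    | cons _ _ => simp at h
  | cons b bs ih =>
    intro P Y Q i0 h
    cases P with
    | nil => simp at h
    | cons l ls =>
      simp only [List.cons_append, ddRows, List.length_cons]
      rw [ih ls Y Q (i0 + 1) (by simpa using h), Bool.and_assoc, show i0 + (bs.length + 1) = i0 + 1 + bs.length by ring]

/-- **Band recombination**: a passing band `[i₀, i₀ + c)` and a passing remainder from `i₀ + c` give the remainder from `i₀`
(for `B`, `L̂` both of length `n`). [folklore] -/
theorem ddRows_drop_of_band {n s : ℕ} {D : List ℤ} {L B : List (List ℤ)} (hB : B.length = n) (hL : L.length = n)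
    {i0 c : ℕ} (hband : ddBand s D L B i0 c = true)
    (hrest : ddRows ((s : ℤ) * s) D L (i0 + c) (B.drop (i0 + c)) (L.drop (i0 + c)) = true) :
    ddRows ((s : ℤ) * s) D L i0 (B.drop i0) (L.drop i0) = true := by
  have eB : B.drop i0 = (B.drop i0).take c ++ B.drop (i0 + c) := by
    rw [← List.drop_drop, List.take_append_drop]
  have eL : L.drop i0 = (L.drop i0).take c ++ L.drop (i0 + c) := by
    rw [← List.drop_drop, List.take_append_drop]
  have hlen : ((B.drop i0).take c).length = ((L.drop i0).take c).length := by
    simp [List.length_take, List.length_drop, hB, hL]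
  rw [eB, eL, ddRows_append _ _ _ _ _ _ _ _ hlen]
  unfold ddBand at hband
  rw [hband, Bool.true_and]
  by_cases h : i0 + c ≤ n
  · have hc : i0 + ((B.drop i0).take c).length = i0 + c := by
      simp [List.length_take, List.length_drop, hB]; omega
    rw [hc]; exact hrest
  · have e1 : B.drop (i0 + c) = [] := List.drop_eq_nil_of_le (by omega)
    have e2 : L.drop (i0 + c) = [] := List.drop_eq_nil_of_le (by omega)
    rw [e1, e2]; simp [ddRows]

/-- The empty remainder passes: `ddRows` from row `n` on. [folklore] -/
theorem ddRows_drop_length {n s : ℕ} {D : List ℤ} {L B : List (List ℤ)} (hB : B.length = n) (i0 : ℕ) (hi : n ≤ i0) :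
    ddRows ((s : ℤ) * s) D L i0 (B.drop i0) (L.drop i0) = true := by
  rw [List.drop_eq_nil_of_le (by omega)]
  rfl

/-! ## §3 Soundness from shape + full diagonal dominance (the core of `PsdCert`, factor-agnostic) -/

/-- **Core soundness** (factor-agnostic): shape facts and diagonal dominance of every residual row give `0 ≤ xᵀBx`.
Identical mathematics to `form_nonneg_of_psdCert`; the factor `(D̂, L̂)` is arbitrary data. [folklore] -/
theorem form_nonneg_of_shape_dd {n s : ℕ} {D : List ℤ} {Lrows B : List (List ℤ)}
    (hshape : psdShape n s D Lrows B = true) (hdd : ddRows ((s : ℤ) * s) D Lrows 0 B Lrows = true)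
    (x : Fin n → ℝ) : 0 ≤ ∑ i : Fin n, ∑ j : Fin n, x i * (ent B i j : ℝ) * x j := by
  unfold psdShape at hshape
  simp only [Bool.and_eq_true, decide_eq_true_eq] at hshape
  obtain ⟨⟨⟨⟨hs, hsq⟩, hsym⟩, hlen⟩, hD⟩ := hshape
  obtain ⟨hBlen, hBrows⟩ := isSquare_spec hsq
  have hBi : ∀ i : Fin n, (B.getD i []).length = n := fun i => by
    rw [List.getD_eq_getElem _ _ (by omega)]; exact hBrows _ (List.getElem_mem _)
  -- the residual kernel and its properties
  set M : ℕ := (Lrows.map List.length).sum with hM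
  let Lf : Fin n → ℕ → ℝ := fun i k => (((Lrows.getD i []).getD k 0 : ℤ) : ℝ)
  let Df : ℕ → ℝ := fun k => ((D.getD k 0 : ℤ) : ℝ)
  let ef : Fin n → Fin n → ℤ := fun i j => ent B i j * ((s : ℤ) * s) - dot3 (Lrows.getD i []) D (Lrows.getD j [])
  have hLi_len : ∀ i : Fin n, (Lrows.getD i []).length ≤ M := fun i => by
    apply length_le_sum_of_mem
    rw [List.getD_eq_getElem _ _ (by omega)]; exact List.getElem_mem _
  -- (1) decomposition  s²·B_ij = Σ_k L_ik D_k L_jk + e_ij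
  have hdec : ∀ i j : Fin n, (ent B i j : ℝ) * ((s : ℝ) * s) = (∑ k ∈ range M, Lf i k * Df k * Lf j k) + (ef i j : ℝ) := by
    intro i j
    have : (ef i j : ℝ) = (ent B i j : ℝ) * ((s : ℝ) * s) - (dot3 (Lrows.getD i []) D (Lrows.getD j []) : ℝ) := by
      simp only [ef]; push_cast; ring
    rw [this, dot3_eq_sum _ _ _ M (hLi_len i)]
    push_cast
    simp only [Lf, Df]
    ring
  -- (2) symmetry of e
  have hesymm : ∀ i j : Fin n, (ef i j : ℝ) = (ef j i : ℝ) := by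
    intro i j
    simp only [ef]
    rw [isSymm_spec hsym i.2 j.2, dot3_comm]
  -- (3) diagonal dominance of e
  have hedd : ∀ i : Fin n, (∑ j : Fin n, if j = i then 0 else |(ef i j : ℝ)|) ≤ (ef i i : ℝ) := by
    intro i
    have hspec := ddRows_spec ((s : ℤ) * s) D Lrows B Lrows 0 hdd i (by omega)
    obtain ⟨-, hrow⟩ := hspec
    simp only [zero_add] at hrow
    have hrlen : (erow ((s : ℤ) * s) D Lrows (B.getD i []) (Lrows.getD i [])).length = n := by
      rw [erow_length, hBi, hlen, min_self]
    rw [offAbs_eq, hrlen] at hrow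
    have hZ : (∑ j : Fin n, if j = i then (0 : ℤ) else |ef i j|) ≤ ef i i := by
      have h1 : (∑ j : Fin n, if j = i then (0 : ℤ) else |ef i j|) =
          ∑ j ∈ range n, if j = (i : ℕ) then (0 : ℤ) else
            |(erow ((s : ℤ) * s) D Lrows (B.getD i []) (Lrows.getD i [])).getD j 0| := by
        rw [← Fin.sum_univ_eq_sum_range (fun j => if j = (i : ℕ) then (0 : ℤ) else
            |(erow ((s : ℤ) * s) D Lrows (B.getD i []) (Lrows.getD i [])).getD j 0|) n]
        refine Finset.sum_congr rfl fun j _ => ?_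
        by_cases hji : j = i
        · subst hji; simp
        · rw [if_neg hji, if_neg (fun h => hji (Fin.ext h)), erow_getD _ _ _ _ _ (hBi i) hlen j.2]
          rfl
      have h2 : (erow ((s : ℤ) * s) D Lrows (B.getD i []) (Lrows.getD i [])).getD i 0 = ef i i := by
        rw [erow_getD _ _ _ _ _ (hBi i) hlen i.2]
        rfl
      rw [h1, ← h2]
      exact hrow
    have hR : ((∑ j : Fin n, if j = i then (0 : ℤ) else |ef i j| : ℤ) : ℝ) ≤ (ef i i : ℝ) := by exact_mod_cast hZ
    push_cast at hR
    exact hR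
  -- (4) assemble
  have hDnn : ∀ k, 0 ≤ Df k := fun k => by
    simp only [Df]; exact_mod_cast getD_nonneg_of_all hD k
  have hgram := form_nonneg_of_gram M Lf Df hDnn x
  have hE := form_nonneg_of_diagDominant (fun i j => (ef i j : ℝ)) hesymm hedd x
  have hsum : (∑ i : Fin n, ∑ j : Fin n, x i * (ent B i j : ℝ) * x j) * ((s : ℝ) * s) =
      (∑ i, ∑ j, x i * (∑ k ∈ range M, Lf i k * Df k * Lf j k) * x j) + ∑ i, ∑ j, x i * (ef i j : ℝ) * x j := by
    rw [← Finset.sum_add_distrib, Finset.sum_mul]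
    refine Finset.sum_congr rfl fun i _ => ?_
    rw [← Finset.sum_add_distrib, Finset.sum_mul]
    refine Finset.sum_congr rfl fun j _ => ?_
    rw [show x i * (ent B i j : ℝ) * x j * ((s : ℝ) * s) = x i * ((ent B i j : ℝ) * ((s : ℝ) * s)) * x j by ring, hdec i j]
    ring
  have hs2 : (0 : ℝ) < (s : ℝ) * s := by positivity
  have htot : 0 ≤ (∑ i : Fin n, ∑ j : Fin n, x i * (ent B i j : ℝ) * x j) * ((s : ℝ) * s) := by
    rw [hsum]; exact add_nonneg hgram hE
  exact (mul_nonneg_iff_of_pos_right hs2).mp htot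

/-- **Soundness of the supplied-factor certificate.** [folklore] -/
theorem form_nonneg_of_psdCertWith {n s : ℕ} {D : List ℤ} {Lrows B : List (List ℤ)}
    (h : psdCertWith n s D Lrows B = true) (x : Fin n → ℝ) :
    0 ≤ ∑ i : Fin n, ∑ j : Fin n, x i * (ent B i j : ℝ) * x j := by
  unfold psdCertWith at h
  simp only [Bool.and_eq_true] at h
  exact form_nonneg_of_shape_dd h.1 h.2 x

/-- `Matrix.PosSemidef` form of the supplied-factor / banded certificate. [folklore] -/
theorem posSemidef_of_shape_dd {n s : ℕ} {D : List ℤ} {Lrows B : List (List ℤ)}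
    (hshape : psdShape n s D Lrows B = true) (hdd : ddRows ((s : ℤ) * s) D Lrows 0 B Lrows = true) :
    (Matrix.of fun i j : Fin n => (ent B i j : ℝ)).PosSemidef := by
  have hsym : isSymm n B = true := by
    unfold psdShape at hshape
    simp only [Bool.and_eq_true, decide_eq_true_eq] at hshape
    exact hshape.1.1.2
  refine Matrix.PosSemidef.of_dotProduct_mulVec_nonneg ?_ fun x => ?_
  · ext i j
    simp only [Matrix.conjTranspose_apply, Matrix.of_apply, star_trivial]
    exact_mod_cast isSymm_spec hsym j.2 i.2
  · have := form_nonneg_of_shape_dd hshape hdd x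
    simp only [dotProduct, Matrix.mulVec, Matrix.of_apply, star_trivial, Finset.mul_sum]
    refine this.trans_eq (Finset.sum_congr rfl fun i _ => Finset.sum_congr rfl fun j _ => by ring)

/-- `Matrix.PosSemidef` form of `psdCertWith`. [folklore] -/
theorem posSemidef_of_psdCertWith {n s : ℕ} {D : List ℤ} {Lrows B : List (List ℤ)}
    (h : psdCertWith n s D Lrows B = true) : (Matrix.of fun i j : Fin n => (ent B i j : ℝ)).PosSemidef := by
  unfold psdCertWith at h
  simp only [Bool.and_eq_true] at h
  exact posSemidef_of_shape_dd h.1 h.2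

/-! ## §4 Smoke test: a supplied factor, two bands -/

/-- `10·[[2,-1,0],[-1,2,-1],[0,-1,2]]` with a supplied fixed-point factor at scale `s = 1024` (pivots `19, 14, 12` of `B − 1`,
rounded) in two row bands `[0,2)` and `[2,3)`: both bands and the shape are decided by the kernel, recombined by
`ddRows_drop_of_band`. [folklore] -/
example : (Matrix.of fun i j : Fin 3 => (ent [[20, -10, 0], [-10, 20, -10], [0, -10, 20]] i j : ℝ)).PosSemidef := by
  have hshape : psdShape 3 1024 [19, 14, 12] [[1024], [-539, 1024], [0, -732, 1024]]
      [[20, -10, 0], [-10, 20, -10], [0, -10, 20]] = true := by decide +kernel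
  have b0 : ddBand 1024 [19, 14, 12] [[1024], [-539, 1024], [0, -732, 1024]]
      [[20, -10, 0], [-10, 20, -10], [0, -10, 20]] 0 2 = true := by decide +kernel
  have b1 : ddBand 1024 [19, 14, 12] [[1024], [-539, 1024], [0, -732, 1024]]
      [[20, -10, 0], [-10, 20, -10], [0, -10, 20]] 2 1 = true := by decide +kernel
  refine posSemidef_of_shape_dd hshape ?_
  have h := ddRows_drop_of_band (n := 3) rfl rfl b0 (ddRows_drop_of_band (n := 3) rfl rfl b1 (ddRows_drop_length (n := 3) rfl 3 le_rfl))
  simpa using h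

end Summit.HubbardSuperconductivity.HubbardLadder.PsdCert
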